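import Mathlib
import HarnessLib
import HarnessLib.Audit
import Summits.ResolutionOfSingularities.Statement
import HarnessLib.Audit.Status.Attr

/-!
Route: WildPurity

DORMANT since 2026-08-25T17:39:23Z (reconciler: no traction for 7.9 d (last activity item-evidence-added at 2026-08-17T19:19:43Z); parked, not closed — `ledger route dormant route-ResolutionOfSingularities-WildPurity --off` to reactivat) — unstaffed, not closed; items shared with open routes are served there. `ledger route dormant <id> --off` reactivates.

# Route WildPurity — exhibit one divisorially unramified but valuatively non-integral wild symbol —
a resolution-free certificate that refutes the summit

REFUTATION-SHAPED certificate route (operator computational-witness; `closes` concludes `¬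
ResolutionOfSingularities`). It suffices to
EXHIBIT X = WildSymbol ∧ PurityTransfer. For a field K finitely generated over a perfect field k of
characteristic p let H³_p(K) be Kato's
group H¹(K, Ω²_log) = Ω²_K/(dΩ¹_K + (F − 1)Ω²_K), taken in its SYMBOLIC presentation (generators [a,
b, c} = "a·dlog b ∧ dlog c", a ∈ K,
b, c ∈ Kˣ; relations: additive in a, multiplicative in b and in c, [a,b,b} = [b,b,c} = [c,b,c} = 0,
[a^p − a, b, c} = 0 — Kato 1982 §1,
Bloch–Kato 1986 Lemma 4.2), and for a local subring T ⊆ K let Unr(T) ⊆ H³_p(K) be the subgroup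
generated by the T-INTEGRAL symbols
(a ∈ T, b, c ∈ Tˣ). WildSymbol (crux 2, THE WITNESS): there are such (p, k, K), a valuation ring O ⊇
k of K, a finitely generated
R ⊆ O with Frac R = K (an affine model of K inside O) and a class α ∈ H³_p(K) that is integral at
EVERY DIVISORIAL valuation ring W ⊇ R of K/k whose centre on R lies inside the centre
of O, yet α ∉ Unr(O). PurityTransfer (crux 3, THE KILLING LEMMA): whenever Spec R admits a
resolution of singularities (`Scheme.HasResolution (Spec R)`, the
summit's own predicate) every such divisorially-integral α IS O-integral (the valuative criterion of
properness lifts Spec O to the regular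
model and yields a finitely generated R ⊆ A ⊆ O, Frac A = K, A regular at the centre — tree theorem
`exists_fg_regular_of_hasResolution`,
PROVED; then Bloch–Ogus purity for logarithmic Hodge–Witt cohomology on that regular local ring,
Gros–Suwa 1988, plus local domination
A_𝔮 ⊆ O). Since the summit hands Spec R a
resolution (ResolutionInChar p instantiated at the affine k-scheme Spec R: reduced, separated,
quasi-compact, of finite type), X refutes
the summit. Card realised:
wild-purity-at-valuations (critic grade new-mechanism), sharpened: O-integrality replaces "death in
the henselisation" (a weaker demand on
the witness, purely algebraic, same killing lemma), typed over Mathlib via the symbol presentation.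
Supports: GlobalPurity (the global
necessary condition "divisorially unramified = valuatively integral" for every function field, from
resolution), LocalCandidate (non-vacuity:
a normal point carrying a divisorially-integral class that does not extend over the point — the
first thing a compute seat decides).
Lean: `WildSymbol ∧ PurityTransfer`

## Assembly
Pure logic over the Statement's own cone (glue.lean `closes`, CRUX-ONLY hypotheses WildSymbol and
PurityTransfer, lean check rc 0, no
Literature import beyond the Statement; axioms propext · Classical.choice · Quot.sound): assume the
summit; unpack WildSymbol into
(p, k, K, O, R with Frac R = K, α, divisorial integrality, non-integrality at O);
`ResolutionOfSingularities_iff` gives `ResolutionInChar p`;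
instantiate it at `Spec R → Spec k` (R is a domain hence reduced; affine hence separated and
quasi-compact; finitely generated hence locally
of finite type — `HasRingHomProperty.Spec_iff` + `RingHom.finiteType_algebraMap`, Mathlib) to get
`Scheme.HasResolution (Spec R)`;
PurityTransfer makes α O-integral — contradiction. The Assembly item `WildSymbol → PurityTransfer →
¬summit` is `closes` verbatim.
Cone repair 2026-08-16: rev 0 imported `Literature.AlgebraicGeometry.Resolution.ResolutionLU` for
the proved bridge
`lurel_of_resolutionInChar`; that module's import closure carries seven unproved named facts
(CossartPiltant2019LU3, CossartPiltant2019Patching,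
CossartPiltant2019LUComplete3, CossartPiltant2019LU3OfComplete, CossartJannsenSaito2020, Temkin2013,
Temkin2013Rel) used by no item, so the
bridge's proved content (the valuative criterion) moved INTO the proof obligation of PurityTransfer
(hypothesis `HasResolution (Spec R)`),
WildSymbol's R became an affine model, and the file imports only the Statement. The items mention
only Mathlib constants, `ResolutionInChar`
and `Scheme.HasResolution`.

Rationale: WHY THIS LINE. Every one of the 22 open routes is a POSITIVE line and every recorded obstruction is
an invariant of a blow-up run; nobody on the ledger can
certify FAILURE of local uniformization at a named valuation short of an infinite forced cycle
(HauserPerlega2019 §1). Arithmetic geometry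
supplies exactly such a certificate: purity for p-primary Kato cohomology on regular schemes
(doi:10.1215/s0012-7094-88-05727-4 Gros–Suwa,
Bloch–Ogus for R^1ε_*Ω^q_log; arXiv:1711.06456, arXiv:1912.10932 for degrees ≤ 2) says a
uniformizable place absorbs every divisorially
unramified wild class, so ONE class α that stays non-integral at a valuation is a finite algebraic
object whose verification — residues
along divisorial valuations (Kato's Swan conductors, doi:10.1007/bfb0061904) and non-integrality at
a rank-one defect place (upper
ramification for ARBITRARY valuation rings, arXiv:1909.09832 Kato–Thatte; AS-defect classification
arXiv:1003.5639 Kuhlmann) — is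
symbolic computation, not a search over blow-up sequences. Imported areas: Galois/flat cohomology of
fields of characteristic p (Kato,
Bloch–Kato), purity theorems (Gros–Suwa, Česnavičius–Scholze), ramification theory of general
valuations (Kato–Thatte, Kuhlmann). What
it does that prior routes and the (empty) negatives index do not: it is the summit's first NEGATIVE
route and the only instrument whose
success refutes the summit and whose failure (a proof of ¬WildSymbol, i.e. of the purity identity
without resolution) is itself a new
theorem implied by, and evidence for, resolution.

RANKED CRUXES. #2 WildSymbol (crux) — THE WITNESS — there exist a prime p, a perfect field k of
characteristic p, a finitely generated field K/k, a valuation ring O ⊇ k of K, a finitely generated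
k-subalgebra R ⊆ O with Frac R = K (an affine model of K inside O) and a class α of the symbolic
H³_p(K) such that α is W-integral for every divisorial valuation ring W of K/k (k ⊆ W, W a DVR
essentially of finite type over k) containing R with centre on R inside the centre of O, but α is
NOT O-integral (card wild-purity-at-valuations K2, sharpened to integrality; rev-3 restatement adds
Frac R = K, equivalent up to enlarging R by an affine model of O). Necessarily trdeg K ≥ 4 and O a
defect place (CossartPiltant2019 + PurityTransfer kill dimension ≤ 3; tame places with divisible
group and residue field k̄ absorb everything). [difficulty: open-problem] (why it might fail:
resolution may simply be true (then PurityTransfer forces ¬WildSymbol); even if not, degree-3 Kato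
classes may be blind to purely inseparable defect (every α dies in K^{1/p}), so a non-uniformizable
place need not carry a witness.) [doi:10.1007/bfb0061904, doi:10.1007/bf02831624, arXiv:1909.09832,
arXiv:1003.5639, arXiv:1802.05010, CutkoskyMourtada2019]
#3 PurityTransfer (crux) — THE KILLING LEMMA (Kato valuative purity above a resolvable affine model)
— for p prime, k perfect of characteristic p, K/k finitely generated, O ⊇ k a valuation ring of K
and R ⊆ O finitely generated with Frac R = K: if Spec R admits a resolution of singularities
(Scheme.HasResolution (Spec R) — the summit predicate at the model; true outright for regular R by
Scheme.IsRegular.hasResolution, which keeps the lemma refutable without unproved facts), then every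
α ∈ H³_p(K) (symbolic) that is W-integral at all divisorial W ⊇ R with centre inside the centre of O
is O-integral. Proof route: valuative criterion of properness ⇒ a finitely generated R ⊆ A ⊆ O, Frac
A = K, regular at the centre 𝔮 = 𝔪_O ∩ A (tree theorem exists_fg_regular_of_hasResolution, PROVED);
the height-one localisations of A_𝔮 are such W; Bloch–Ogus exactness 0 → H³_p(A_𝔮) → H³_p(K) → ⊕_{ht
P = 1} H²_p(κ(P)) on the smooth local ring A_𝔮 (Gros–Suwa); H³_p(A_𝔮) is generated by A_𝔮-integral
symbols (Bloch–Kato Lemma 4.2, Cartier); A_𝔮 ⊆ O is a local domination, so A_𝔮-integral ⇒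
O-integral. [difficulty: M] (why it might fail: the typed symbolic group must be EXACTLY Kato's
H³_p(K) (a missing or surplus relation makes the purity step false or vacuous), and Bloch–Ogus for
R¹ε_*Ω²_log is printed for smooth schemes over perfect fields only — transcription risks; the added
valuative-criterion step is a proved tree theorem.) [doi:10.1215/s0012-7094-88-05727-4,
doi:10.1007/bf02831624, doi:10.1007/bfb0061904, zbl:1149.14013, arXiv:1711.06456]
#9 GlobalPurity (support) — GLOBAL NECESSARY CONDITION — if ResolutionInChar p holds then for every
finitely generated K over a perfect k of characteristic p, every α ∈ H³_p(K) (symbolic) that is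
integral at ALL divisorial valuation rings of K/k is integral at EVERY valuation ring O ⊇ k of K
("divisorially unramified = valuatively integral"; the card's FinWild_3). Proof: regular proper
model, centre of O on it, Bloch–Ogus purity at the centre, local domination. Unconditional in trdeg
≤ 3 via CossartPiltant2019. [difficulty: provable-now] [doi:10.1215/s0012-7094-88-05727-4,
arXiv:1806.02668, CossartPiltant2019]
#9 LocalCandidate (support) — NON-VACUITY (card K1, typed) — some NORMAL affine point (R integrally
closed in K = Frac R, centre = centre of a valuation ring O) carries a class α ∈ H³_p(K) that is
integral at every divisorial W ⊇ R centred inside that centre but is NOT integral at the local ring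
of the point; a necessary condition for a WildSymbol at that point, decidable germ by germ (Cartier
operator on local cohomology of Z Ω² at isolated hypersurface fourfold points, arXiv:1912.10932
locating the live degree), and meaningful whether or not resolution holds. [difficulty: M]
[arXiv:1912.10932, doi:10.1007/bf02831624, arXiv:1802.05010]

TWO-LAYER PLAN. Foreseen glued splits (none filed now): WildSymbol ⇐ LocalCandidateAt(a named
non-quasi-homogeneous fourfold germ, e.g. Cossart–Piltant's
Remark 3.2 hypersurface or a Hauser–Perlega kangaroo lift) → DefectSurvival (one candidate class
stays non-integral at an explicit
rank-one defect place, by Kato–Thatte upper ramification) → WildSymbol; PurityTransfer ⇐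
SymbolPresentation (the typed group is Kato's
H³_p) → BlochOgusH3 (Gros–Suwa exactness on smooth local rings) → PurityTransfer, the lift of Spec O
to the regular model being the
proved tree theorem exists_fg_regular_of_hasResolution (ResolutionLU.lean; imported by the prover's
Theorems file, not by the route).

KILL CRITERIA. ¬WildSymbol proved ("every divisorially integral wild degree-3 class is valuatively
integral", for all function fields over perfect fields)
closes the route `refuted:WildSymbol` — and is banked as a NEW necessary condition for resolution
now known unconditionally (evidence FOR the
summit); ¬LocalCandidate proved (no normal point carries a non-extending divisorially integral
class) kills WildSymbol a fortiori. PurityTransfer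
refuted (on a regular model R, where HasResolution holds by Scheme.IsRegular.hasResolution) can only
mean a mis-transcribed relation or purity scope:
repair as refuted-misstated (new item with the corrected presentation).
The summit proved elsewhere moots the route (WildSymbol then false). A witness found closes the
SUMMIT refuted.

NOT DECOMPOSED YET. The choice of germ and of defect valuation for the witness (layer-2 children of
WildSymbol); the degree-2 (p-Brauer) variant at non-lci or
non-isolated centres and the flat α_p-coefficient variant (other certificates of the same shape,
filed only if degree 3 proves vacuous);
the card's converse criterion K3 ("all obstructions vanish ⇒ LU") is deliberately NOT filed — it has
no mechanism and would be a costume.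

CHEAPEST FALSIFIER. (i) Calibration, by lookup: any purported witness with trdeg K ≤ 3, or at a
tame/Abhyankar place, or with O discrete of residue
transcendence degree trdeg K − 1, is impossible (CossartPiltant2019 + PurityTransfer;
KnafKuhlmann2005) — a claimed α there exposes a
mis-typed relation. (ii) The card's unrun linear algebra: at the isolated wild fourfold germs z^p +
Σ_{i≤4} u_i^{p+1} (p = 2, 3) compute
ker(1 − C) on H²_𝔪(ZΩ²_A) modulo A-integral symbols; if it is zero for these and for
Cossart–Piltant's Remark 3.2 germ, LocalCandidate fails
at isolated hypersurface points and witnesses must sit on non-isolated strata. Not run this session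
(needs a Čech model of ZΩ² over A^p;
it is the first kit job of whoever takes WildSymbol or LocalCandidate). (iii) Literature: a proof of
"H³_p divisorially unramified =
valuatively unramified" WITHOUT resolution would kill WildSymbol — searched (below), found only for
smooth proper models (arXiv:1806.02668
Thm 3.2) with the singular case explicitly deferred to resolution (Rem 3.3).

NUMBERS. Degree bookkeeping: degree 1 (Z/p, α_p torsors) is vacuous as a certificate (Zariski–Nagata
+ Temkin2013: O_1 = 0); degree 2 (p-Brauer)
is vacuous at lci points of dimension ≥ 4 (arXiv:1912.10932 Thm 1.3: Br(U_R) = Br(R)); degree 3 =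
H¹(−, Ω²_log) is the first live degree
at fourfold hypersurface points (flat purity stops at i < dim R = 4). Dimension: witnesses need
trdeg K ≥ 4 (CossartPiltant2019). Items at
open: 5 (2 cruxes, 2 supports, 1 assembly); after the cone repair of 2026-08-16 still 5 active: both
cruxes restated (WildSymbol: R an affine model;
PurityTransfer: hypothesis HasResolution (Spec R)), 2 supports, 1 assembly = `closes` verbatim; the
interim support LurelFromResolution (rev 1) was dropped.

DEFINITION REQUESTS. D1 KatoCohomologySymbolic (topic Literature/NumberTheory/GaloisCohomology):
H^q_p(K) for q = 1, 2, 3 of a field of characteristic p by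
Kato's presentation K ⊗ (Kˣ)^{⊗(q−1)}/J (doi:10.1007/bfb0061904 §1; doi:10.1007/bf02831624 Lemma
4.2), with the comparison to
Ω^{q−1}/(d + (F − 1)) as a named fact; the route's items inline the q = 3 case by `let` and should
be restated over D1 once it lands.
D2 IntegralSymbols Unr(T) ⊆ H^q_p(K) for a subring T ⊆ K and D3 DivisorialPlace (k ⊆ W ⊆ K a DVR
essentially of finite type over k)
(topic Literature/AlgebraicGeometry/Resolution). Cite facts wanted: GrosSuwa1988 (Bloch–Ogus for
R^1ε_*Ω^q_log on smooth schemes over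
perfect fields), Kato1982 §1 / BlochKato1986 Lemma 4.2 (symbol presentation), CesnaviciusScholze2024
Thm 1.3.

Novelty: Searches (2026-08-16, this seat): `lit search --source zbmath` ×9 — "Swan conductor valuation" (8:
Kato–Thatte arXiv:1909.09832,
Kato–Leal–Saito, Kato 1987/1989 — ramification tools, none pointed at LU), "Galois cohomology of
complete discrete valuation fields"
(Kato 1982 found), "conjecture de Gersten faisceaux Hodge-Witt logarithmique" (Gros–Suwa 1988),
"Purity for the Brauer group" / "Purity
for flat cohomology" (Česnavičius 2019, Česnavičius–Scholze 2024, Gabber 1998), "local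
uniformization cohomological obstruction valuation" (0),
"Kato cohomology valuation ring purity unramified" (0), "unramified cohomology p-torsion positive
characteristic resolution singularities" (0),
"Artin-Schreier defect extensions valued fields Kuhlmann" (5, incl. arXiv:2503.13157 ramification
ideals); `lit galaxy search --star all`
"obstruction to local uniformization" (0), "Brauer group local uniformization" (0); `lit read
doi:10.1007/bf02831624` pp. 16–17 (Lemma 4.2
verified on the page); the card's and its two critics' searches (galaxy 'local uniformization' 71
rows none cohomological; zbMATH 'local
uniformization cohomological' → only ILO arXiv:1207.3648, direction LU ⇒ cohomology); grep of 185
cards / 22 route files / all crux lines: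
no route or line uses Brauer, Milnor-K, Kato or flat cohomology of the function field (hits: the
card itself; incidental mentions in
quantum-frobenius-symbol-order, rational-places-made-discrete).
Nearest prior art found: arXiv:1806.02668 (Auel–Bigazzi–Böhning–  [refs: 10.1007/bf02831624`, 1909.09832, 2503.13157, 1207.3648, 1806.02668, doi:10.1007/bf02831624]

Barriers (technique_class: valuative-wild-purity, kato-certificate, refutation): - technique_class: valuative-wild-purity, kato-certificate, refutation
- Literature.Barriers.ResolutionOfSingularities.DimensionFourFrontier: not evaded but consumed — the
frontier says exactly where a witness can live (trdeg K ≥ 4; in dimension ≤ 3 PurityTransfer +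
CossartPiltant2019 force integrality, which is the route's calibration test).
- Literature.Barriers.ResolutionOfSingularities.Cutkosky2014: consistent and used — the barrier's
technique class (monomialize a finite map along ν) is not invoked; its lesson (defect is the
obstruction) is where WildSymbol hunts: only defect places can fail to absorb a divisorially
integral class.
- Literature.Barriers.ResolutionOfSingularities.Hauser2003_kangarooShadeIncrease: outside its
technique class — no blow-up is performed, no order/shade/residual-order invariant is tracked;
Hauser–Perlega runs enter only as suppliers of candidate defect valuations.
- Literature.Barriers.ResolutionOfSingularities.hauserPerlega_mohProofBoundFails: same — nothing
here bounds a residual order; the route answers HP's "such an example would disprove resolution"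
with a certificate that needs no forced cycle.
- Literature.Barriers.ResolutionOfSingularities.chevalley_barrier: orthogonal — no
Puiseux/uniformizer roots are expanded; Artin–Schreier defect extensions of K^h_ν are where
non-integrality is detected (Kato–Thatte), not an obstacle.
- Literature.Barriers.ResolutionOfSingularities.InseparableBaseChange: respected — both cruxes live
over PERFECT g

History (route lifecycle, newest last):
- 2026-08-16T22:32:16Z · rev 3: restated WildSymbol (stmt-ResolutionOfSingularities-17031) — cone repair, staging step 2/4: WildSymbol restated 1:1 — the finitely generated R ⊆ O is now required to be an affine MODEL of K (conjunct `IsFractionRing R K` (planner-rrepair-ResolutionOfSingularities-Wild-eb48ec34-0)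
- 2026-08-16T22:32:55Z · rev 4: restated PurityTransfer (stmt-ResolutionOfSingularities-17032) — cone repair, staging step 3/4: PurityTransfer restated 1:1 — hypothesis "(K, O, R) admits a relative local uniformization" replaced by "Frac R = K and Scheme.Ha (planner-rrepair-ResolutionOfSingularities-Wild-eb48ec34-0)
- 2026-08-16T22:33:55Z · rev 5: dropped LurelFromResolution — cone repair, step 4/4 (final): crux-only deciding theorem `closes (hW : WildSymbol) (hP : PurityTransfer) : ¬ ResolutionOfSingularities` — the summit is instant (planner-rrepair-ResolutionOfSingularities-Wild-eb48ec34-0)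
- 2026-08-25T17:39:23Z · DORMANT — reconciler: no traction for 7.9 d (last activity item-evidence-added at 2026-08-17T19:19:43Z); parked, not closed — `ledger route dormant route-ResolutionOfSing (operator:999:2904993)

sub-problem: ResolutionOfSingularities · status: dormant · opened planner-plan-novel-ResolutionOfSingularities-Re-dc19aa3a-d-v2-g11-0 2026-08-16T22:15:51Z · rev 5 · ledger route-ResolutionOfSingularities-WildPurity
GENERATED by the gate from the ledger (D-0016/17). Provers cite these decls: `theorem foo : Summit.ResolutionOfSingularities.ResolutionOfSingularities.Theses.WildPurity.<Decl> := …` in Summits/ResolutionOfSingularities/ResolutionOfSingularities/Theorems/<Name>.lean.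
-/

namespace Summit.ResolutionOfSingularities.ResolutionOfSingularities.Theses.WildPurity

open scoped BigOperators Topology Manifold Classical MeasureTheory ProbabilityTheory Matrix InnerProductSpace ComplexConjugate ContinuousMap
open Filter Set Function TopologicalSpace MeasureTheory

attribute [summit_statement] _root_.ResolutionOfSingularities

-- earlier WildSymbol (stmt-ResolutionOfSingularities-17031, replaced 2026-08-16T22:32:16Z -> stmt-ResolutionOfSingularities-17133): retired by None — ∃ p : ℕ, p.Prime ∧ ∃ (k K : Type) (_ : Field k) (_ : CharP k p) (_ : PerfectField k) (_ : Field K) (_ : Algebra k K), (⊤ : IntermediateField k K).FG ∧ ∃ O : ValuationSubring K, (∀ c : k, algebraMap k K c ∈ O) ∧ ∃ R : Subalgebra k K, R.FG ∧ R.toSubring 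
/-- item stmt-ResolutionOfSingularities-17133 · crux · rank 2 · open · by planner
why it might fail: resolution may simply be true (then PurityTransfer forces ¬WildSymbol); even if not, degree-3 Kato classes may be blind to purely inseparable defect (every α dies in K^{1/p}), so a non-uniformizable place need not carry a witness.
sources: doi:10.1007/bfb0061904, doi:10.1007/bf02831624, arXiv:1909.09832, arXiv:1003.5639, arXiv:1802.05010, CutkoskyMourtada2019
[crux] THE WITNESS — there exist a prime p, a perfect field k of characteristic p, a finitely
generated field K/k, a valuation ring O ⊇ k of K, a finitely generated k-subalgebra R ⊆ O WITH Frac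
R = K (an affine model of K inside O) and a class α of the symbolic H³_p(K) such that α is
W-integral for every divisorial valuation ring W of K/k (k ⊆ W, W a DVR essentially of finite type
over k) containing R with centre on R inside the centre of O, but α is NOT O-integral (card
wild-purity-at-valuations K2, sharpened to integrality). Equivalent to the rev-0 statement (enlarge
R by an affine model of O; fewer divisorial W then constrain α); the model condition lets `closes`
hand Spec R to the summit directly. Necessarily trdeg K ≥ 4 and O a defect place (CossartPiltant2019
+ PurityTransfer kill dimension ≤ 3; tame places with divisible group and residue field k̄ absorb
everything). [difficulty: open-problem] -/
@[route_item "route-ResolutionOfSingularities-WildPurity", crux]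
def WildSymbol : Prop :=
  ∃ p : ℕ, p.Prime ∧ ∃ (k K : Type) (_ : Field k) (_ : CharP k p) (_ : PerfectField k) (_ : Field K) (_ : Algebra k K), (⊤ : IntermediateField k K).FG ∧ ∃ O : ValuationSubring K, (∀ c : k, algebraMap k K c ∈ O) ∧ ∃ R : Subalgebra k K, R.FG ∧ R.toSubring ≤ O.toSubring ∧ IsFractionRing R K ∧ (let G := FreeAbelianGroup (K × Kˣ × Kˣ); let N : AddSubgroup G := AddSubgroup.closure { x | (∃ (a a' : K) (b c : Kˣ), x = .of (a + a', b, c) - .of (a, b, c) - .of (a', b, c)) ∨ (∃ (a : K) (b b' c : Kˣ), x = .of (a, b * b', c) - .of (a, b, c) - .of (a, b', c)) ∨ (∃ (a : K) (b c c' : Kˣ), x = .of (a, b, c * c') - .of (a, b, c) - .of (a, b, c')) ∨ (∃ (a : K) (b : Kˣ), x = .of (a, b, b)) ∨ (∃ (b c : Kˣ), x = .of ((b : K), b, c)) ∨ (∃ (b c : Kˣ), x = .of ((c : K), b, c)) ∨ (∃ (a : K) (b c : Kˣ), x = .of (a ^ p - a, b, c)) }; let Unr : Subring K → AddSubgroup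 (G ⧸ N) := fun T => AddSubgroup.closure { y | ∃ (a : K) (b c : Kˣ), a ∈ T ∧ (b : K) ∈ T ∧ ((b⁻¹ : Kˣ) : K) ∈ T ∧ (c : K) ∈ T ∧ ((c⁻¹ : Kˣ) : K) ∈ T ∧ y = ((FreeAbelianGroup.of (a, b, c) : G) : G ⧸ N) }; ∃ α : G ⧸ N, (∀ W : ValuationSubring K, (∀ c : k, algebraMap k K c ∈ W) → IsDiscreteValuationRing W → (∃ B : Subalgebra k K, B.FG ∧ B.toSubring ≤ W.toSubring ∧ ∀ x : K, x ∈ W → ∃ b s : K, b ∈ B ∧ s ∈ B ∧ s ∉ W.nonunits ∧ x * s = b) → R.toSubring ≤ W.toSubring → (∀ x : K, x ∈ R → x ∈ W.nonunits → x ∈ O.nonunits) → α ∈ Unr W.toSubring) ∧ α ∉ Unr O.toSubring)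

-- earlier PurityTransfer (stmt-ResolutionOfSingularities-17032, replaced 2026-08-16T22:32:55Z -> stmt-ResolutionOfSingularities-17142): retired by None — ∀ p : ℕ, p.Prime → ∀ (k K : Type) [Field k] [CharP k p] [PerfectField k] [Field K] [Algebra k K], (⊤ : IntermediateField k K).FG → ∀ O : ValuationSubring K, (∀ c : k, algebraMap k K c ∈ O) → ∀ R : Subalgebra k K, R.FG → R.toSubring ≤ O.toSubring → 
/-- item stmt-ResolutionOfSingularities-17142 · crux · rank 3 · open · by planner
why it might fail: the typed symbolic group must be EXACTLY Kato's H³_p(K) (a missing or surplus relation makes the purity step false or vacuous), and Bloch–Ogus for R¹ε_*Ω²_log is printed for smooth schemes over perfect fields only — transcription risks; the added valuative-criterion step is a proved tree theorem.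
sources: doi:10.1215/s0012-7094-88-05727-4, doi:10.1007/bf02831624, doi:10.1007/bfb0061904, zbl:1149.14013, arXiv:1711.06456
[crux] THE KILLING LEMMA (Kato valuative purity above a resolvable affine model) — for p prime, k
perfect of characteristic p, K/k finitely generated, O ⊇ k a valuation ring of K and R ⊆ O a
finitely generated k-subalgebra with Frac R = K: if Spec R admits a resolution of singularities
(`Scheme.HasResolution (Spec R)`, the summit predicate, fed by `closes` from ResolutionInChar p;
unconditionally true when R is regular — `Scheme.IsRegular.hasResolution` — so the lemma stays
refutable on regular models without any unproved fact), then every α ∈ H³_p(K) (symbolic) that is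
W-integral at all divisorial W ⊇ R with centre inside the centre of O is O-integral. Proof route:
valuative criterion of properness lifts Spec O to the regular model (tree theorem
`exists_fg_regular_of_hasResolution`, ResolutionLU.lean, PROVED: a finitely generated R ⊆ A ⊆ O,
Frac A = K, A_𝔮 regular at the centre 𝔮 = 𝔪_O ∩ A); the height-one localisations of A_𝔮 are
divisorial W ⊇ R centred inside the centre of O; Bloch–Ogus exactness 0 → H³_p(A_𝔮) → H³_p(K) →
⊕_{ht P = 1} H²_p(κ(P)) on the smooth local ring A_𝔮 (Gros–Suwa); H³_p(A_𝔮) is generated by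
A_𝔮-integral symbols (Bloch–Kato Lemma 4.2, Cartier); A_𝔮 ⊆ O is a -/
@[route_item "route-ResolutionOfSingularities-WildPurity", crux]
def PurityTransfer : Prop :=
  ∀ p : ℕ, p.Prime → ∀ (k K : Type) [Field k] [CharP k p] [PerfectField k] [Field K] [Algebra k K], (⊤ : IntermediateField k K).FG → ∀ O : ValuationSubring K, (∀ c : k, algebraMap k K c ∈ O) → ∀ R : Subalgebra k K, R.FG → R.toSubring ≤ O.toSubring → IsFractionRing R K → Literature.AlgebraicGeometry.Resolution.Scheme.HasResolution (AlgebraicGeometry.Spec (CommRingCat.of R)) → (let G := FreeAbelianGroup (K × Kˣ × Kˣ); let N : AddSubgroup G := AddSubgroup.closure { x | (∃ (a a' : K) (b c : Kˣ), x = .of (a + a', b, c) - .of (a, b, c) - .of (a', b, c)) ∨ (∃ (a : K) (b b' c : Kˣ), x = .of (a, b * b', c) - .of (a, b, c) - .of (a, b', c)) ∨ (∃ (a : K) (b c c' : Kˣ), x = .of (a, b, c * c') - .of (a, b, c) - .of (a, b, c')) ∨ (∃ (a : K) (b : Kˣ), x = .of (a, b, b)) ∨ (∃ (b c : Kˣ),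 x = .of ((b : K), b, c)) ∨ (∃ (b c : Kˣ), x = .of ((c : K), b, c)) ∨ (∃ (a : K) (b c : Kˣ), x = .of (a ^ p - a, b, c)) }; let Unr : Subring K → AddSubgroup (G ⧸ N) := fun T => AddSubgroup.closure { y | ∃ (a : K) (b c : Kˣ), a ∈ T ∧ (b : K) ∈ T ∧ ((b⁻¹ : Kˣ) : K) ∈ T ∧ (c : K) ∈ T ∧ ((c⁻¹ : Kˣ) : K) ∈ T ∧ y = ((FreeAbelianGroup.of (a, b, c) : G) : G ⧸ N) }; ∀ α : G ⧸ N, (∀ W : ValuationSubring K, (∀ c : k, algebraMap k K c ∈ W) → IsDiscreteValuationRing W → (∃ B : Subalgebra k K, B.FG ∧ B.toSubring ≤ W.toSubring ∧ ∀ x : K, x ∈ W → ∃ b s : K, b ∈ B ∧ s ∈ B ∧ s ∉ W.nonunits ∧ x * s = b) → R.toSubring ≤ W.toSubring → (∀ x : K, x ∈ R → x ∈ W.nonunits → x ∈ O.nonunits) → α ∈ Unr W.toSubring) → α ∈ Unr O.toSubring)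

/-- item stmt-ResolutionOfSingularities-17033 · support · rank 9 · open · by planner
sources: doi:10.1215/s0012-7094-88-05727-4, arXiv:1806.02668, CossartPiltant2019
[support] GLOBAL NECESSARY CONDITION — if ResolutionInChar p holds then for every finitely generated
K over a perfect k of characteristic p, every α ∈ H³_p(K) (symbolic) that is integral at ALL
divisorial valuation rings of K/k is integral at EVERY valuation ring O ⊇ k of K ("divisorially
unramified = valuatively integral"; the card's FinWild_3). Proof: regular proper model, centre of O
on it, Bloch–Ogus purity at the centre, local domination. Unconditional in trdeg ≤ 3 via
CossartPiltant2019. [difficulty: provable-now] -/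
@[route_item "route-ResolutionOfSingularities-WildPurity"]
def GlobalPurity : Prop :=
  ∀ p : ℕ, p.Prime → Literature.AlgebraicGeometry.Resolution.ResolutionInChar.{0} p → ∀ (k K : Type) [Field k] [CharP k p] [PerfectField k] [Field K] [Algebra k K], (⊤ : IntermediateField k K).FG → (let G := FreeAbelianGroup (K × Kˣ × Kˣ); let N : AddSubgroup G := AddSubgroup.closure { x | (∃ (a a' : K) (b c : Kˣ), x = .of (a + a', b, c) - .of (a, b, c) - .of (a', b, c)) ∨ (∃ (a : K) (b b' c : Kˣ), x = .of (a, b * b', c) - .of (a, b, c) - .of (a, b', c)) ∨ (∃ (a : K) (b c c' : Kˣ), x = .of (a, b, c * c') - .of (a, b, c) - .of (a, b, c')) ∨ (∃ (a : K) (b : Kˣ), x = .of (a, b, b)) ∨ (∃ (b c : Kˣ), x = .of ((b : K), b, c)) ∨ (∃ (b c : Kˣ), x = .of ((c : K), b, c)) ∨ (∃ (a : K) (b c : Kˣ), x = .of (a ^ p - a, b, c)) }; let Unr : Subring K → AddSubgroup (G ⧸ N) := fun T => AddSubgroup.closure { y | ∃ (a : K) (b c : Kˣ), a ∈ T ∧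 (b : K) ∈ T ∧ ((b⁻¹ : Kˣ) : K) ∈ T ∧ (c : K) ∈ T ∧ ((c⁻¹ : Kˣ) : K) ∈ T ∧ y = ((FreeAbelianGroup.of (a, b, c) : G) : G ⧸ N) }; ∀ α : G ⧸ N, (∀ W : ValuationSubring K, (∀ c : k, algebraMap k K c ∈ W) → IsDiscreteValuationRing W → (∃ B : Subalgebra k K, B.FG ∧ B.toSubring ≤ W.toSubring ∧ ∀ x : K, x ∈ W → ∃ b s : K, b ∈ B ∧ s ∈ B ∧ s ∉ W.nonunits ∧ x * s = b) → α ∈ Unr W.toSubring) → ∀ O : ValuationSubring K, (∀ c : k, algebraMap k K c ∈ O) → α ∈ Unr O.toSubring)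

/-- item stmt-ResolutionOfSingularities-17034 · support · rank 9 · open · by planner
sources: arXiv:1912.10932, doi:10.1007/bf02831624, arXiv:1802.05010
[support] NON-VACUITY (card K1, typed) — some NORMAL affine point (R integrally closed in K = Frac
R, centre = centre of a valuation ring O) carries a class α ∈ H³_p(K) that is integral at every
divisorial W ⊇ R centred inside that centre but is NOT integral at the local ring of the point; a
necessary condition for a WildSymbol at that point, decidable germ by germ (Cartier operator on
local cohomology of Z Ω² at isolated hypersurface fourfold points, arXiv:1912.10932 locating the
live degree), and meaningful whether or not resolution holds. [difficulty: M] -/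
@[route_item "route-ResolutionOfSingularities-WildPurity"]
def LocalCandidate : Prop :=
  ∃ p : ℕ, p.Prime ∧ ∃ (k K : Type) (_ : Field k) (_ : CharP k p) (_ : PerfectField k) (_ : Field K) (_ : Algebra k K), (⊤ : IntermediateField k K).FG ∧ ∃ O : ValuationSubring K, (∀ c : k, algebraMap k K c ∈ O) ∧ ∃ R : Subalgebra k K, R.FG ∧ R.toSubring ≤ O.toSubring ∧ IsFractionRing R K ∧ IsIntegrallyClosedIn R K ∧ (let G := FreeAbelianGroup (K × Kˣ × Kˣ); let N : AddSubgroup G := AddSubgroup.closure { x | (∃ (a a' : K) (b c : Kˣ), x = .of (a + a', b, c) - .of (a, b, c) - .of (a', b, c)) ∨ (∃ (a : K) (b b' c : Kˣ), x = .of (a, b * b', c) - .of (a, b, c) - .of (a, b', c)) ∨ (∃ (a : K) (b c c' : Kˣ), x = .of (a, b, c * c') - .of (a, b, c) - .of (a, b, c')) ∨ (∃ (a : K) (b : Kˣ), x = .of (a, b, b)) ∨ (∃ (b c : Kˣ), x = .of ((b : K), b, c)) ∨ (∃ (b c : Kˣ), x = .of ((c : K), b, c)) ∨ (∃ (a : K)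 (b c : Kˣ), x = .of (a ^ p - a, b, c)) }; let Unr : Subring K → AddSubgroup (G ⧸ N) := fun T => AddSubgroup.closure { y | ∃ (a : K) (b c : Kˣ), a ∈ T ∧ (b : K) ∈ T ∧ ((b⁻¹ : Kˣ) : K) ∈ T ∧ (c : K) ∈ T ∧ ((c⁻¹ : Kˣ) : K) ∈ T ∧ y = ((FreeAbelianGroup.of (a, b, c) : G) : G ⧸ N) }; ∃ α : G ⧸ N, (∀ W : ValuationSubring K, (∀ c : k, algebraMap k K c ∈ W) → IsDiscreteValuationRing W → (∃ B : Subalgebra k K, B.FG ∧ B.toSubring ≤ W.toSubring ∧ ∀ x : K, x ∈ W → ∃ b s : K, b ∈ B ∧ s ∈ B ∧ s ∉ W.nonunits ∧ x * s = b) → R.toSubring ≤ W.toSubring → (∀ x : K, x ∈ R → x ∈ W.nonunits → x ∈ O.nonunits) → α ∈ Unr W.toSubring) ∧ α ∉ Unr (Subring.closure { x : K | ∃ r s : K, r ∈ R ∧ s ∈ R ∧ s ∉ O.nonunits ∧ x * s = r }))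

/-- item stmt-ResolutionOfSingularities-17035 · assembly · rank 1 · open · by planner
sources: doi:10.1215/s0012-7094-88-05727-4, doi:10.1007/bfb0061904
[assembly] WildSymbol → PurityTransfer → ¬ ResolutionOfSingularities (refutation shape). -/
@[route_item "route-ResolutionOfSingularities-WildPurity"]
def Assembly : Prop :=
  WildSymbol → PurityTransfer → ¬ _root_.ResolutionOfSingularities

/-! D-0027 §2.1 — DECIDING THEOREM (planner-authored via `route open/edit --closes-file`; by planner-rrepair-ResolutionOfSingularities-Wild-eb48ec34-0 2026-08-16T22:33:55Z):
its hypotheses are this route's items and its conclusion the sub-problem Statement (glue_lint), and it elaborates with this file. -/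

/-- Deciding theorem (REFUTATION shape, D-0027 §2.1 with `--refutation`; crux-only, no Literature import beyond the
Statement): a live wild symbol above an affine model `R` of `K` inside `O`, together with Kato valuative purity above
resolvable affine models, refutes the summit. Proof: unpack the witness `(p, k, K, O, R, α)`; the summit gives
`ResolutionInChar p` (`ResolutionOfSingularities_iff`); instantiate it at the affine `k`-scheme `Spec R → Spec k`
(reduced: `R` is a domain; separated and quasi-compact: affine; locally of finite type: `R` is finitely generated,
`HasRingHomProperty.Spec_iff`) to get `Scheme.HasResolution (Spec R)`; `PurityTransfer` then makes `α` `O`-integral,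
contradicting the witness. Axioms propext · Classical.choice · Quot.sound. -/
@[closes "route-ResolutionOfSingularities-WildPurity"] theorem closes (hW : WildSymbol) (hP : PurityTransfer) : ¬ _root_.ResolutionOfSingularities := by
  intro hRes
  obtain ⟨p, hp, k, K, _, _, _, _, _, hfg, O, hO, R, hR, hRO, hfr, α, hdiv, hα⟩ := hW
  have h : Literature.AlgebraicGeometry.Resolution.ResolutionInChar.{0} p :=
    (_root_.ResolutionOfSingularities_iff).1 hRes p hp
  haveI : Algebra.FiniteType k R := R.fg_iff_finiteType.mp hR
  -- the summit, instantiated at the affine model `Spec R → Spec k` (reduced: `R` is a domain;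
  -- separated and quasi-compact: affine; locally of finite type: `R` is finitely generated)
  have hres : Literature.AlgebraicGeometry.Resolution.Scheme.HasResolution
      (AlgebraicGeometry.Spec (CommRingCat.of R)) := by
    let f : AlgebraicGeometry.Spec (.of R) ⟶ AlgebraicGeometry.Spec (.of k) :=
      AlgebraicGeometry.Spec.map (CommRingCat.ofHom (algebraMap k R))
    haveI : AlgebraicGeometry.LocallyOfFiniteType f :=
      (AlgebraicGeometry.HasRingHomProperty.Spec_iff
        (P := @AlgebraicGeometry.LocallyOfFiniteType)).mpr (RingHom.finiteType_algebraMap.mpr ‹_›)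
    exact h k (AlgebraicGeometry.Spec (.of R)) f inferInstance inferInstance inferInstance inferInstance
  exact hα (hP p hp k K hfg O hO R hR hRO hfr hres α hdiv)

end Summit.ResolutionOfSingularities.ResolutionOfSingularities.Theses.WildPurity
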